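import Mathlib

/-!
# Crux `ArithStatLadder.IqThreeNotPPoly` (stmt-QuantumAdvantage-2422)

Stub `stub_hittingSet` of the line `Sketch` (Adleman's union bound / hitting-set lemma; pure finite
combinatorics, Mathlib only).

If at most `2 ^ N` sets `G i ⊆ Ω` (`i ∈ M`) each have density at least `1 / q` in the finite
nonempty type `Ω`, then some tuple of `(N + 1) * q` points of `Ω` meets every `G i`.

Proof: the tuples `t : Fin k → Ω` missing a fixed `G i` form the product set
`Fintype.piFinset fun _ => (G i)ᶜ` of cardinality `(|Ω| - |G i|) ^ k`; from `|Ω| ≤ q |G i|` we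
get `q (|Ω| - |G i|) ≤ |Ω| (q - 1)`, hence `q ^ k (|Ω| - |G i|) ^ k ≤ |Ω| ^ k (q - 1) ^ k`;
summing over `i ∈ M` and using `2 ^ N (q - 1) ^ k < q ^ k` for `k = (N + 1) q` (from
`2 (q - 1) ^ q < q ^ q`, two terms of the binomial expansion) the union of the bad sets is smaller
than the set of all tuples, so some tuple lies outside every bad set. Everything is done in `ℕ`.
-/

set_option linter.dupNamespace false -- D-0017: single-problem summit ⇒ `QuantumAdvantage.QuantumAdvantage` by design

namespace Summit.QuantumAdvantage.QuantumAdvantage.Theorems.IqThreeNotPPoly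

/-- Two-term binomial lower bound: `a ^ (n + 1) + (n + 1) a ^ n ≤ (a + 1) ^ (n + 1)`. -/
theorem pow_succ_add_succ_mul_pow_le (a n : ℕ) :
    a ^ (n + 1) + (n + 1) * a ^ n ≤ (a + 1) ^ (n + 1) := by
  induction n with
  | zero => simp
  | succ n ih =>
    have expand : (a ^ (n + 1) + (n + 1) * a ^ n) * (a + 1)
        = a ^ (n + 1 + 1) + (n + 1 + 1) * a ^ (n + 1) + (n + 1) * a ^ n := by ring
    calc a ^ (n + 1 + 1) + (n + 1 + 1) * a ^ (n + 1)
        ≤ a ^ (n + 1 + 1) + (n + 1 + 1) * a ^ (n + 1) + (n + 1) * a ^ n := Nat.le_add_right _ _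
      _ = (a ^ (n + 1) + (n + 1) * a ^ n) * (a + 1) := expand.symm
      _ ≤ (a + 1) ^ (n + 1) * (a + 1) := Nat.mul_le_mul_right _ ih
      _ = (a + 1) ^ (n + 1 + 1) := (pow_succ _ _).symm

/-- The numerical heart of the union bound: `2 (q - 1) ^ q < q ^ q` for `1 ≤ q`. -/
theorem two_mul_pred_pow_lt {q : ℕ} (hq : 1 ≤ q) : 2 * (q - 1) ^ q < q ^ q := by
  obtain ⟨m, rfl⟩ : ∃ m, q = m + 1 := ⟨q - 1, by omega⟩
  rw [Nat.add_sub_cancel]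
  rcases Nat.eq_zero_or_pos m with rfl | hm
  · simp
  · have hmm : 0 < m ^ m := pow_pos hm m
    calc 2 * m ^ (m + 1) = m ^ (m + 1) + m * m ^ m := by ring
      _ < m ^ (m + 1) + (m + 1) * m ^ m := by nlinarith [hmm]
      _ ≤ (m + 1) ^ (m + 1) := pow_succ_add_succ_mul_pow_le m m

/-- `2 ^ N (q - 1) ^ ((N + 1) q) < q ^ ((N + 1) q)` for `1 ≤ q`. -/
theorem two_pow_mul_pred_pow_lt (N : ℕ) {q : ℕ} (hq : 1 ≤ q) :
    2 ^ N * (q - 1) ^ ((N + 1) * q) < q ^ ((N + 1) * q) := by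
  rw [pow_mul', pow_mul']
  calc 2 ^ N * ((q - 1) ^ q) ^ (N + 1)
      ≤ 2 ^ (N + 1) * ((q - 1) ^ q) ^ (N + 1) :=
        Nat.mul_le_mul_right _ (Nat.pow_le_pow_right (by norm_num) (Nat.le_succ N))
    _ = (2 * (q - 1) ^ q) ^ (N + 1) := (Nat.mul_pow _ _ _).symm
    _ < (q ^ q) ^ (N + 1) := Nat.pow_lt_pow_left (two_mul_pred_pow_lt hq) (Nat.succ_ne_zero N)

/-- From `n ≤ q g` and `g ≤ n`: `q (n - g) ≤ n (q - 1)` (the density step, in `ℕ`). -/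
theorem mul_sub_le_mul_pred {n g q : ℕ} (h : n ≤ q * g) (hg : g ≤ n) :
    q * (n - g) ≤ n * (q - 1) := by
  rcases Nat.eq_zero_or_pos q with rfl | hq
  · simp
  obtain ⟨q', rfl⟩ : ∃ q', q = q' + 1 := ⟨q - 1, by omega⟩
  obtain ⟨d, rfl⟩ : ∃ d, n = d + g := ⟨n - g, by omega⟩
  rw [Nat.add_sub_cancel, Nat.add_sub_cancel]
  nlinarith [h]

/-- **Hitting-set lemma (Adleman's union bound).** If `M` has at most `2 ^ N` elements and every
`G i` (`i ∈ M`) has density at least `1 / q` in the finite nonempty type `Ω`, then some tuple of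
`(N + 1) * q` elements of `Ω` meets every `G i`. -/
theorem stub_hittingSet :
    ∀ (Ω : Type) [Fintype Ω] [Nonempty Ω] (ι : Type) (M : Finset ι) (G : ι → Finset Ω) (N q : ℕ),
      1 ≤ q → M.card ≤ 2 ^ N → (∀ i ∈ M, Fintype.card Ω ≤ q * (G i).card) →
        ∃ t : Fin ((N + 1) * q) → Ω, ∀ i ∈ M, ∃ j, t j ∈ G i := by
  intro Ω _ _ ι M G N q hq hM hG
  classical
  have key := two_pow_mul_pred_pow_lt N hq
  generalize (N + 1) * q = k at key ⊢
  -- the bad tuples for `i` (those missing `G i`) and their number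
  have hper : ∀ i ∈ M, q ^ k * (Fintype.piFinset fun _ : Fin k => (G i)ᶜ).card
      ≤ Fintype.card Ω ^ k * (q - 1) ^ k := by
    intro i hi
    rw [Fintype.card_piFinset_const, Finset.card_compl, ← Nat.mul_pow, ← Nat.mul_pow]
    exact Nat.pow_le_pow_left (mul_sub_le_mul_pred (hG i hi) (Finset.card_le_univ _)) k
  -- the union of the bad sets is smaller than the set of all tuples
  have hlt : (M.biUnion fun i => Fintype.piFinset fun _ : Fin k => (G i)ᶜ).card
      < (Finset.univ : Finset (Fin k → Ω)).card := by
    have hΩ : 0 < Fintype.card Ω := Fintype.card_pos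
    have hsum : q ^ k * ∑ i ∈ M, (Fintype.piFinset fun _ : Fin k => (G i)ᶜ).card
        < q ^ k * Fintype.card Ω ^ k :=
      calc q ^ k * ∑ i ∈ M, (Fintype.piFinset fun _ : Fin k => (G i)ᶜ).card
          = ∑ i ∈ M, q ^ k * (Fintype.piFinset fun _ : Fin k => (G i)ᶜ).card :=
            Finset.mul_sum _ _ _
        _ ≤ ∑ _i ∈ M, Fintype.card Ω ^ k * (q - 1) ^ k := Finset.sum_le_sum hper
        _ = M.card * (Fintype.card Ω ^ k * (q - 1) ^ k) := by
            rw [Finset.sum_const, smul_eq_mul]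
        _ ≤ 2 ^ N * (Fintype.card Ω ^ k * (q - 1) ^ k) := Nat.mul_le_mul_right _ hM
        _ = Fintype.card Ω ^ k * (2 ^ N * (q - 1) ^ k) := by ring
        _ < Fintype.card Ω ^ k * q ^ k := mul_lt_mul_of_pos_left key (pow_pos hΩ k)
        _ = q ^ k * Fintype.card Ω ^ k := mul_comm _ _
    calc (M.biUnion fun i => Fintype.piFinset fun _ : Fin k => (G i)ᶜ).card
        ≤ ∑ i ∈ M, (Fintype.piFinset fun _ : Fin k => (G i)ᶜ).card := Finset.card_biUnion_le
      _ < Fintype.card Ω ^ k := lt_of_mul_lt_mul_left hsum (Nat.zero_le _)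
      _ = (Finset.univ : Finset (Fin k → Ω)).card := by
          rw [Finset.card_univ, Fintype.card_pi_const]
  -- a tuple outside every bad set hits every `G i`
  obtain ⟨t, -, ht⟩ := Finset.exists_mem_notMem_of_card_lt_card hlt
  refine ⟨t, fun i hi => ?_⟩
  have hti : t ∉ Fintype.piFinset fun _ : Fin k => (G i)ᶜ := fun h =>
    ht (Finset.mem_biUnion.2 ⟨i, hi, h⟩)
  simpa [Fintype.mem_piFinset] using hti

end Summit.QuantumAdvantage.QuantumAdvantage.Theorems.IqThreeNotPPoly
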